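import Summits.ResolutionOfSingularities.ResolutionOfSingularities.Theorems.ValuativeLuAlphaPTorsorCurveMonomializationDivisors
import Summits.ResolutionOfSingularities.ResolutionOfSingularities.Theorems.ValuativeLuAlphaPTorsorCurveMonomializationStep
import Summits.ResolutionOfSingularities.ResolutionOfSingularities.Theorems.ValuativeLuAlphaPTorsorCurveMonomializationResidue
import Summits.ResolutionOfSingularities.ResolutionOfSingularities.Theorems.ValuativeLuAlphaPTorsorCurveMonomializationNormalization

/-!
# A branch followed for ever by the valuation becomes regular (Herrmann–Ikeda–Orbanz (30.2))

Helper file for the stub `stub_curveMonomialization` of the line `pfaff-line-log-final-forms`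
(crux `Valuative.LuAlphaPTorsor`, item `stmt-ResolutionOfSingularities-0641`).

Let `R₀ → R₁ → ⋯` be the quadratic sequence of a two-dimensional regular local ring `R₀` of `K`
along a valuation ring `O` dominating it, and `W ⊋ O` a valuation ring of `K` (a coarsening of
`O`, so `Rᵢ ⊆ W` for all `i`: the branch `𝔪_W ∩ Rᵢ` of `Spec Rᵢ` is *followed for ever* by `O`)
which does not dominate `R₀`. Suppose the one-dimensional prime quotients of `R₀` have finite
normalisation (the hypothesis of the stub). PROVED (`exists_regular_parameter_of_followed`):
**for some `c` the centre `𝔪_W ∩ R_c` is generated by an element `q ∉ 𝔪_{R_c}²`** (the branch is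
regular at the centre of `O` on `R_c`). Proof (Herrmann–Ikeda–Orbanz, proof of Thm. (30.2)):
`W = (R₀)_𝔮₀` with `𝔮₀ = 𝔪_W ∩ R₀` of height one; the images `Dⱼ` of the `Rⱼ` in `κ(W)` form the
quadratic sequence of the one-dimensional local domain `D₀ ≅ R₀/𝔮₀` along the valuation ring
`O'' = O/𝔪_W` of `κ(W) = Frac D₀` (granted as the hypothesis `hstepD`, proved in
`…CurveMonomializationReduction.lean`); the normalisation `N` of `D₀` is finite (hypothesis) and
`O'' = N_n` (`…CurveMonomializationNormalization.lean`), so `D_c = O''` for some `c`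
(`exists_sequence_eq_valuationSubring`); then `𝔪_{D_c}` is principal, and lifting a generator,
`𝔪_{R_c} = (g, q)` with `(q) = 𝔪_W ∩ R_c` (`exists_not_mem_sq_of_residue_eq`).
[cite: HerrmannIkedaOrbanz1988, Thm. (30.2) (proof)]
-/

set_option linter.dupNamespace false

namespace Summit.ResolutionOfSingularities.ResolutionOfSingularities.Theorems.PfaffLine.CurveMono

open IsLocalRing Literature.AlgebraicGeometry.Resolution

variable {K : Type} [Field K]

/-- **Lifting a uniformiser.** Let `S ⊆ O ⊆ W` with `S` a two-dimensional regular local ring of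
`K` dominated by `O` but not by `W`, `w(b) > 0` for some `0 ≠ b ∈ S`, and suppose the image
`π(S)` of `S` in `κ(W)` is all of `O'' = π(O)`. Then `π(S) ≅ S/(𝔪_W ∩ S)` is a Noetherian
valuation ring, its maximal ideal is principal, and lifting a generator `g`:
`𝔪_S = (q, g)` where `(q) = 𝔪_W ∩ S`; in particular `q ∉ 𝔪_S²`.
[cite: HerrmannIkedaOrbanz1988, Thm. (30.2) (proof)] -/
theorem exists_not_mem_sq_of_residue_eq {O W : ValuationSubring K} (hOW : O ≤ W)
    {O'' : ValuationSubring (ResidueField W)}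
    (hO'' : O''.toSubring = (O.toSubring.comap W.subtype).map (residue W))
    {S : Subring K} [IsRegularLocalRing S] (hdim : ringKrullDim S = 2) (hof : IsLocalRingOf S)
    (hSO : SubringDominates S O.toSubring) (hnd : ¬ SubringDominates S W.toSubring)
    {b : K} (hbS : b ∈ S) (hb0 : b ≠ 0) (hbW : W.valuation b < 1)
    (hc : (S.comap W.subtype).map (residue W) = O''.toSubring) :
    ∃ q : S, W.valuation (q : K) < 1 ∧ q ∉ maximalIdeal S ^ 2 := by
  have hSW : S ≤ W.toSubring := fun x hx => hOW (hSO.1 hx)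
  have hval : ∀ z : ResidueField W, z ∈ (S.comap W.subtype).map (residue W) ∨
      z⁻¹ ∈ (S.comap W.subtype).map (residue W) := fun z => by
    rw [hc]; exact O''.mem_or_inv_mem z
  have hDO'' : ∀ z : ResidueField W, z ∈ (S.comap W.subtype).map (residue W) ↔ z ∈ O'' :=
    fun z => by rw [hc]; rfl
  set D : Subring (ResidueField W) := (S.comap W.subtype).map (residue W) with hD
  haveI : IsLocalRing D := isLocalRing_residue hSW
  haveI : IsNoetherianRing D := isNoetherianRing_residue hSW
  -- `D = O''` is a Noetherian valuation ring of `κ(W)`: its maximal ideal is principal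
  haveI : ValuationRing D := by
    refine { cond' := fun a c => ?_ }
    rcases hval ((a : ResidueField W) / c) with hz | hz
    · by_cases hc0 : (c : ResidueField W) = 0
      · exact ⟨0, Or.inl (Subtype.ext (by simp [hc0]))⟩
      · refine ⟨⟨_, hz⟩, Or.inr (Subtype.ext ?_)⟩
        change (c : ResidueField W) * (a / c) = a
        field_simp
    · by_cases ha : (a : ResidueField W) = 0
      · exact ⟨0, Or.inr (Subtype.ext (by simp [ha]))⟩
      · refine ⟨⟨_, hz⟩, Or.inl (Subtype.ext ?_)⟩
        change (a : ResidueField W) * ((a : ResidueField W) / c)⁻¹ = c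
        by_cases hc0 : (c : ResidueField W) = 0
        · simp [hc0]
        · field_simp
  haveI : IsPrincipalIdealRing D :=
    ((tfae_of_isNoetherianRing_of_isLocalRing_of_isDomain D).out 0 1).mpr ‹_›
  obtain ⟨gbar, hgbar⟩ := (IsPrincipalIdealRing.principal (maximalIdeal D)).principal
  have hgbar' : maximalIdeal D = Ideal.span {gbar} := hgbar
  -- lift the generator to `S`
  obtain ⟨wg, hwg, hwggbar⟩ := gbar.2
  -- the centre of `W` on `S` is `(q)`
  obtain ⟨𝔮, h𝔮, hmem𝔮, h𝔮m, -, -, -, -⟩ := exists_centre hdim hof hSW hnd hbS hb0 hbW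
  obtain ⟨q, hq⟩ := exists_eq_span_singleton_of_ne_maximalIdeal hdim 𝔮 h𝔮m
  have hq𝔮 : q ∈ 𝔮 := by rw [hq]; exact Ideal.mem_span_singleton_self q
  have hqW : W.valuation (q : K) < 1 := (hmem𝔮 q).mp hq𝔮
  -- `𝔪_S = (q, g)`
  have hmax : maximalIdeal S = Ideal.span {q, ⟨(wg : K), hwg⟩} := by
    apply le_antisymm
    · intro y hy
      have hyO : O.valuation (y : K) < 1 := valuation_lt_one_of_dominates hSO hy
      have hyres : O''.valuation (residue W ⟨y, hSW y.2⟩) < 1 :=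
        (residue_valuation_lt_one_iff hOW hO'' (z := ⟨y, hSW y.2⟩) (hSO.1 y.2)).mpr hyO
      have hyD : residue W ⟨y, hSW y.2⟩ ∈ D := ⟨⟨y, hSW y.2⟩, y.2, rfl⟩
      have hym : (⟨_, hyD⟩ : D) ∈ maximalIdeal D := by
        rw [mem_maximalIdeal_iff_inv_not_mem]
        rcases (valuation_lt_one_iff_or O'' _).mp hyres with h0 | hinv
        · exact Or.inl h0
        · exact Or.inr fun hmem => hinv ((hDO'' _).mp hmem)
      rw [hgbar', Ideal.mem_span_singleton'] at hym
      obtain ⟨d, hd⟩ := hym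
      obtain ⟨wd, hwd, hwdd⟩ := d.2
      -- `π(y - d g) = 0`, so `y - d g ∈ 𝔮 = (q)`
      have hdiff : residue W (⟨(y : K), hSW y.2⟩ - wd * wg) = 0 := by
        rw [map_sub, map_mul, hwdd, hwggbar, sub_eq_zero]
        have e := congrArg (fun x : D => (x : ResidueField W)) hd
        simp only [Subring.coe_mul] at e
        exact e.symm
      rw [IsLocalRing.residue_eq_zero_iff, ValuationSubring.valuation_lt_one_iff] at hdiff
      have hmemq : y - ⟨(wd : K), hwd⟩ * ⟨(wg : K), hwg⟩ ∈ Ideal.span {q} := by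
        rw [← hq, hmem𝔮]
        exact hdiff
      obtain ⟨c, hc'⟩ := Ideal.mem_span_singleton'.mp hmemq
      rw [Ideal.mem_span_pair]
      exact ⟨c, ⟨(wd : K), hwd⟩, by rw [hc']; ring⟩
    · rw [Ideal.span_le]
      rintro _ (rfl | rfl)
      · exact IsLocalRing.le_maximalIdeal h𝔮.ne_top hq𝔮
      · -- `g ∈ 𝔪_S`: `π(g)` generates `𝔪_D`, so has positive `O''`-value
        rw [SetLike.mem_coe, mem_maximalIdeal_iff_inv_not_mem]
        have hgbarm : gbar ∈ maximalIdeal D := by rw [hgbar']; exact Ideal.mem_span_singleton_self gbar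
        rw [mem_maximalIdeal_iff_inv_not_mem] at hgbarm
        have hgbarval : O''.valuation (gbar : ResidueField W) < 1 := by
          rw [valuation_lt_one_iff_or]
          exact hgbarm.imp_right fun h hO => h ((hDO'' _).mpr hO)
        have hwgval : O.valuation (wg : K) < 1 := by
          rw [← hwggbar] at hgbarval
          exact (residue_valuation_lt_one_iff hOW hO'' (hSO.1 hwg)).mp hgbarval
        rcases (valuation_lt_one_iff_or O _).mp hwgval with h0 | hinv
        · exact Or.inl h0
        · exact Or.inr fun h => hinv (hSO.1 h)
  exact ⟨q, hqW, not_mem_sq_of_span_pair hdim hmax⟩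

/-- **A branch followed for ever becomes regular (Herrmann–Ikeda–Orbanz, proof of
Thm. (30.2)).** Let `R₀ → R₁ → ⋯` be the quadratic sequence along `O` of the two-dimensional
regular local ring `R₀` of `K` (all `Rᵢ` two-dimensional regular), whose one-dimensional prime
quotients have finite normalisation, and `W ⊇ O` a proper valuation ring of `K` not dominating
`R₀`. Granted that the images of the `Rⱼ` in `κ(W)` form a quadratic sequence along `O'' = π(O)`
(`hstepD`), there are `c` and `q ∈ R_c` with `w(q) > 0` and `q ∉ 𝔪_{R_c}²`.
[cite: HerrmannIkedaOrbanz1988, Thm. (30.2) (proof)] -/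
theorem exists_regular_parameter_of_followed {O W : ValuationSubring K} {R : ℕ → Subring K}
    (hreg : ∀ i, IsRegularLocalRing (R i)) (hdim : ∀ i, ringKrullDim (R i) = 2)
    (hof : IsLocalRingOf (R 0)) (h0 : SubringDominates (R 0) O.toSubring)
    (hstep : ∀ i, IsQuadraticTransformAlong O (R i) (R (i + 1)))
    (hfin : ∀ (𝔮 : Ideal (R 0)) (L : Type) [Field L] [Algebra (R 0 ⧸ 𝔮) L]
      [IsFractionRing (R 0 ⧸ 𝔮) L], 𝔮.IsPrime → ringKrullDim (R 0 ⧸ 𝔮) = 1 →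
        Module.Finite (R 0 ⧸ 𝔮) (integralClosure (R 0 ⧸ 𝔮) L))
    (hOW : O ≤ W) (htop : W ≠ ⊤) (hnd : ¬ SubringDominates (R 0) W.toSubring)
    (hstepD : ∀ O'' : ValuationSubring (ResidueField W),
      O''.toSubring = (O.toSubring.comap W.subtype).map (residue W) →
        ∀ j, IsQuadraticTransformAlong O'' (((R j).comap W.subtype).map (residue W))
          (((R (j + 1)).comap W.subtype).map (residue W))) :
    ∃ (c : ℕ) (q : R c), W.valuation (q : K) < 1 ∧ q ∉ maximalIdeal (R c) ^ 2 := by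
  classical
  haveI := hreg
  have hmono : Monotone R := sequence_monotone hstep
  have hdomO : ∀ i, SubringDominates (R i) O.toSubring := fun i => (sequence_dominates h0 hstep i).1
  have hdom0 : ∀ i, SubringDominates (R 0) (R i) := fun i => (sequence_dominates h0 hstep i).2
  have hRW : ∀ i, R i ≤ W.toSubring := fun i x hx => hOW ((hdomO i).1 hx)
  have hndi : ∀ i, ¬ SubringDominates (R i) W.toSubring := fun i =>
    not_dominates_of_dominates (hdom0 i) hnd
  have hofi : ∀ i, IsLocalRingOf (R i) := fun i => isLocalRingOf_of_le hof (hmono (Nat.zero_le i))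
  -- the valuation ring `O''` of `κ(W)`
  obtain ⟨O'', hO''⟩ := exists_residue_valuationSubring hOW
  -- an element `b ∈ R 0` of positive `W`-value
  obtain ⟨b, hbR, hb0, hbW⟩ : ∃ b ∈ R 0, b ≠ 0 ∧ W.valuation b < 1 := by
    obtain ⟨z, hz⟩ : ∃ z : K, z ∉ W := by
      by_contra hall
      push Not at hall
      exact htop (eq_top_iff.mpr fun z _ => hall z)
    obtain ⟨a, ha, s, hs, hs0, rfl⟩ := hof.2 z
    refine ⟨s, hs, hs0, ?_⟩
    by_contra hlt
    apply hz
    rw [div_eq_mul_inv]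
    exact W.mul_mem _ _ (hRW 0 ha) (inv_mem_of_not_lt (hRW 0 hs) hlt)
  -- `W = (R 0)_𝔮₀`
  obtain ⟨𝔮₀, h𝔮₀, hmem𝔮₀, h𝔮₀m, -, -, hWeq, -⟩ :=
    exists_centre (hdim 0) hof (hRW 0) hnd hbR hb0 hbW
  have hfrac : ∀ z ∈ W, ∃ a ∈ R 0, ∃ s ∈ R 0, ¬ W.valuation s < 1 ∧ z = a / s := by
    intro z hz
    have hz' : z ∈ (LocalSubring.ofPrime (R 0) 𝔮₀).toSubring := by rw [← hWeq]; exact hz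
    obtain ⟨a, s, hs, rfl⟩ := mem_ofPrime_iff.mp hz'
    exact ⟨a, a.2, s, s.2, fun h => hs ((hmem𝔮₀ s).mpr h), rfl⟩
  -- the reduced sequence
  set D : ℕ → Subring (ResidueField W) := fun j => ((R j).comap W.subtype).map (residue W)
    with hD
  haveI hDnoeth : IsNoetherianRing (D 0) := isNoetherianRing_residue (hRW 0)
  haveI hDdim : Ring.KrullDimLE 1 (D 0) :=
    Ring.krullDimLE_iff.mpr (ringKrullDim_residue_le_one (hRW 0) (hdim 0) hbR hb0 hbW)
  have hofD : IsLocalRingOf (D 0) := isLocalRingOf_residue (hRW 0) hfrac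
  have h0D : SubringDominates (D 0) O''.toSubring := subringDominates_residue hOW hO'' h0
  have hstepD' : ∀ j, IsQuadraticTransformAlong O'' (D j) (D (j + 1)) := hstepD O'' hO''
  -- the finiteness hypothesis for `𝔮 = ker (R 0 → κ(W))`
  let θ₀ : R 0 →+* ResidueField W := (residue W).comp (Subring.inclusion (hRW 0))
  have hθ₀ : ∀ y : R 0, θ₀ y = residue W ⟨(y : K), hRW 0 y.2⟩ := fun y => rfl
  have hker : ∀ y : R 0, y ∈ RingHom.ker θ₀ ↔ W.valuation (y : K) < 1 := fun y => by
    rw [RingHom.mem_ker, hθ₀, IsLocalRing.residue_eq_zero_iff, ValuationSubring.valuation_lt_one_iff]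
  haveI : (RingHom.ker θ₀).IsPrime := RingHom.ker_isPrime θ₀
  set Q := R 0 ⧸ RingHom.ker θ₀ with hQ
  letI : Algebra Q (ResidueField W) := (RingHom.kerLift θ₀).toAlgebra
  have halg : ∀ y : R 0, algebraMap Q (ResidueField W) (Ideal.Quotient.mk _ y) = θ₀ y :=
    fun y => RingHom.kerLift_mk θ₀ y
  haveI : FaithfulSMul Q (ResidueField W) :=
    (faithfulSMul_iff_algebraMap_injective Q _).mpr (RingHom.kerLift_injective θ₀)
  haveI : IsFractionRing Q (ResidueField W) := by
    refine IsFractionRing.of_field (R := Q) (K := ResidueField W) (surj := fun z => ?_)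
    obtain ⟨w, rfl⟩ := IsLocalRing.residue_surjective z
    obtain ⟨a, ha, s, hs, hvs, hwe⟩ := hfrac w w.2
    have hvs1 : W.valuation s = 1 := valuation_eq_one_of_not_lt (hRW 0 hs) hvs
    obtain ⟨h, hdiv, -⟩ := residue_div (hRW 0 ha) (hRW 0 hs) hvs1
    refine ⟨Ideal.Quotient.mk _ ⟨a, ha⟩, Ideal.Quotient.mk _ ⟨s, hs⟩, ?_⟩
    rw [halg, halg, hθ₀, hθ₀, ← hdiv]
    congr 1
    exact Subtype.ext hwe
  -- `dim (R 0 / 𝔮) = 1`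
  have hQle : ringKrullDim Q ≤ 1 := by
    have hble : Ideal.span {(⟨b, hbR⟩ : R 0)} ≤ RingHom.ker θ₀ := by
      rw [Ideal.span_singleton_le_iff_mem, hker]
      exact hbW
    have h1 : ringKrullDim Q ≤ ringKrullDim (R 0 ⧸ Ideal.span {(⟨b, hbR⟩ : R 0)}) :=
      ringKrullDim_le_of_surjective (Ideal.Quotient.factor hble)
        (Ideal.Quotient.factor_surjective hble)
    have hb0' : (⟨b, hbR⟩ : R 0) ≠ 0 := fun h => hb0 (congrArg Subtype.val h)
    have h2 : ringKrullDim (R 0 ⧸ Ideal.span {(⟨b, hbR⟩ : R 0)}) + 1 ≤ ringKrullDim (R 0) :=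
      ringKrullDim_quotient_succ_le_of_nonZeroDivisor (mem_nonZeroDivisors_of_ne_zero hb0')
    rw [hdim 0, ← one_add_one_eq_two] at h2
    exact h1.trans (ENat.WithBot.add_le_add_one_right_iff.mp h2)
  have hkerm : RingHom.ker θ₀ ≠ maximalIdeal (R 0) := by
    intro h
    apply h𝔮₀m
    ext y
    rw [hmem𝔮₀, ← hker, h]
  have hQnf : ¬ IsField Q := by
    change ¬ IsField (R 0 ⧸ RingHom.ker θ₀)
    rw [← Ideal.Quotient.maximal_ideal_iff_isField_quotient]
    exact fun hmax => hkerm (IsLocalRing.eq_maximalIdeal hmax)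
  have hQdim : ringKrullDim Q = 1 := by
    refine le_antisymm hQle ?_
    by_contra hlt
    rw [not_le] at hlt
    haveI : Ring.KrullDimLE 0 Q := Ring.krullDimLE_iff.mpr (ENat.WithBot.lt_add_one_iff.mp hlt)
    exact hQnf Ring.KrullDimLE.isField_of_isDomain
  haveI hfinQ : Module.Finite Q (integralClosure Q (ResidueField W)) :=
    hfin (RingHom.ker θ₀) (ResidueField W) inferInstance hQdim
  -- "`V = N_n`"
  haveI : Ring.DimensionLEOne Q := by
    haveI : Ring.KrullDimLE 1 Q := Ring.krullDimLE_iff.mpr hQle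
    exact ⟨fun h1 h2 => (Ring.krullDimLE_one_iff_of_isPrime_bot.mp inferInstance) _ h1 h2⟩
  have hO''top : O'' ≠ ⊤ := by
    have hne : O ≠ W := fun h => hnd (h ▸ h0)
    obtain ⟨z, hzW, hzO⟩ := SetLike.exists_of_lt (lt_of_le_of_ne hOW hne)
    intro htop'
    have hmem : residue W ⟨z, hzW⟩ ∈ O'' := by rw [htop']; exact ValuationSubring.mem_top _
    obtain ⟨t, ht, hte⟩ := exists_of_mem_residue hO'' hmem
    have hzt : residue W (⟨z, hzW⟩ - t) = 0 := by rw [map_sub, hte, sub_self]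
    rw [IsLocalRing.residue_eq_zero_iff, ValuationSubring.valuation_lt_one_iff] at hzt
    have hzt' : O.valuation (((⟨z, hzW⟩ - t : W) : K)) < 1 := valuation_lt_one_of_le hOW hzt
    have hztO : ((⟨z, hzW⟩ - t : W) : K) ∈ O := (O.valuation_le_one_iff _).mp hzt'.le
    apply hzO
    have e : z = ((⟨z, hzW⟩ - t : W) : K) + t := by push_cast; ring
    rw [e]
    exact O.add_mem _ _ hztO ht
  have hAO : ∀ a : Q, algebraMap Q (ResidueField W) a ∈ O'' := by
    intro a
    obtain ⟨y, rfl⟩ := Ideal.Quotient.mk_surjective a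
    rw [halg, hθ₀]
    exact residue_mem hO'' ((hdomO 0).1 y.2)
  have hdomA : ∀ a : Q, ¬ IsUnit a → O''.valuation (algebraMap Q (ResidueField W) a) < 1 := by
    intro a ha
    obtain ⟨y, rfl⟩ := Ideal.Quotient.mk_surjective a
    rw [halg, hθ₀]
    have hy : y ∈ maximalIdeal (R 0) := by
      rw [IsLocalRing.mem_maximalIdeal]
      exact fun hu => ha (hu.map _)
    exact (residue_valuation_lt_one_iff hOW hO'' ((hdomO 0).1 y.2)).mpr
      (valuation_lt_one_of_dominates h0 hy)
  obtain ⟨hNO, hON⟩ := integralClosure_le_and_le_locAtCentre hQnf O'' hO''top hAO hdomA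
  -- generators of the normalisation over `Q`
  obtain ⟨s, hs⟩ := Module.Finite.fg_top (R := Q) (M := integralClosure Q (ResidueField W))
  set S : Finset (ResidueField W) :=
    s.image (fun c : integralClosure Q (ResidueField W) => (c : ResidueField W)) with hS
  have hSN : (S : Set (ResidueField W)) ⊆ (integralClosure Q (ResidueField W)).toSubring := by
    intro x hx
    rw [hS, Finset.coe_image] at hx
    obtain ⟨c, -, rfl⟩ := hx
    exact c.2
  have hNS : (integralClosure Q (ResidueField W)).toSubring ≤
      Subring.closure ((D 0 : Set (ResidueField W)) ∪ ↑S) := by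
    have key : ∀ x ∈ Submodule.span Q (s : Set (integralClosure Q (ResidueField W))),
        (x : ResidueField W) ∈ Subring.closure ((D 0 : Set (ResidueField W)) ∪ ↑S) := by
      intro x hx
      induction hx using Submodule.span_induction with
      | mem x hx =>
        refine Subring.subset_closure (Or.inr ?_)
        rw [hS, Finset.coe_image]
        exact ⟨x, hx, rfl⟩
      | zero => exact Subring.zero_mem _
      | add x y _ _ hx hy => exact Subring.add_mem _ hx hy
      | smul a x _ hx =>
        obtain ⟨y, rfl⟩ := Ideal.Quotient.mk_surjective a
        rw [Subalgebra.coe_smul, Algebra.smul_def, halg, hθ₀]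
        exact Subring.mul_mem _ (Subring.subset_closure (Or.inl ⟨⟨y, hRW 0 y.2⟩, y.2, rfl⟩)) hx
    intro c hc
    have hcmem : (⟨c, hc⟩ : integralClosure Q (ResidueField W)) ∈
        Submodule.span Q (s : Set (integralClosure Q (ResidueField W))) := by
      rw [hs]; exact Submodule.mem_top
    exact key _ hcmem
  -- the reduced sequence reaches `O''`; at that stage the branch is regular
  obtain ⟨c, hc⟩ := exists_sequence_eq_valuationSubring (A := D) hofD h0D hstepD' hNO S hSN
    hNS hON
  exact ⟨c, exists_not_mem_sq_of_residue_eq hOW hO'' (hdim c) (hofi c) (hdomO c) (hndi c)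
    (hmono (Nat.zero_le c) hbR) hb0 hbW hc⟩

end Summit.ResolutionOfSingularities.ResolutionOfSingularities.Theorems.PfaffLine.CurveMono

namespace Summit.ResolutionOfSingularities.ResolutionOfSingularities.Theorems.PfaffLine

/-- **Registered sub-goal `curveMono_exists_regular_parameter_of_followed`** (universe `0`, for
`--supports` registration): a branch followed for ever by the valuation becomes regular after
finitely many quadratic transforms (Herrmann–Ikeda–Orbanz, proof of Thm. (30.2)), granted the
reduction of the sequence modulo the branch. [cite: HerrmannIkedaOrbanz1988, Thm. (30.2) (proof)] -/
theorem curveMono_exists_regular_parameter_of_followed : ∀ {K : Type} [Field K] {O W : ValuationSubring K} {R : ℕ → Subring K} (hreg : ∀ i, IsRegularLocalRing (R i)), (∀ i, ringKrullDim (R i) = 2) → Literature.AlgebraicGeometry.Resolution.IsLocalRingOf (R 0) → Literature.AlgebraicGeometry.Resolution.SubringDominates (R 0) O.toSubring → (∀ i, Literature.AlgebraicGeometry.Resolution.IsQuadraticTransformAlong O (R i) (R (i + 1))) → (∀ (𝔮 : Ideal (R 0)) (L : Type) [Field L] [Algebra (R 0 ⧸ 𝔮) L] [IsFractionRing (R 0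 ⧸ 𝔮) L], 𝔮.IsPrime → ringKrullDim (R 0 ⧸ 𝔮) = 1 → Module.Finite (R 0 ⧸ 𝔮) (integralClosure (R 0 ⧸ 𝔮) L)) → O ≤ W → W ≠ ⊤ → ¬ Literature.AlgebraicGeometry.Resolution.SubringDominates (R 0) W.toSubring → (∀ O'' : ValuationSubring (IsLocalRing.ResidueField W), O''.toSubring = (O.toSubring.comap W.subtype).map (IsLocalRing.residue W) → ∀ j, Literature.AlgebraicGeometry.Resolution.IsQuadraticTransformAlong O'' (((R j).comap W.subtype).map (IsLocalRing.residue W)) (((R (j + 1)).comap W.subtype).map (IsLocalRing.residue W))) → ∃ (c : ℕ) (q : R c), W.valuation (q : K) < 1 ∧ q ∉ IsLocalRing.maximalIdeal (R c) ^ 2 := by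
  intro K _ O W R hreg hdim hof h0 hstep hfin hOW htop hnd hstepD
  exact CurveMono.exists_regular_parameter_of_followed hreg hdim hof h0 hstep hfin hOW htop hnd hstepD

end Summit.ResolutionOfSingularities.ResolutionOfSingularities.Theorems.PfaffLine
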